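import Literature.MathematicalPhysics.QuantumFieldTheory.Balaban1983to89.B1Ineq358TreeDecaySum

/-!
# `Balaban1983to89.B2Ineq2116TreeDecayRegion` — T. Bałaban, *(Higgs)₂,₃ quantum fields in a finite volume. II. An upper bound*,
Commun. Math. Phys. **86** (1982) 555–594 [Balaban1982Higgs2]: the SUMMATION behind the region-sized remainders of Sect. 2 —
(2.57) p. 570 *"+ O((Lᵏε)^{κ₀})|Λ₇^{(k−1)′} ∩ Λ₇^{(k)c}|"*, Prop. 2.6 p. 580 *"the interaction terms localized in Bᵏ(Λ₇^{(k)}) … can be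
estimated by O((Lᵏε)^κ)|Λ₇^{(k)}|"* and (2.116) p. 582 *"𝒫^{(K),Lᴷε}(Λ₇^{(K−1)}, B^{(K),ε}, ψ) ≦ O((Lᴷε)^{κ₀})|Λ₇^{(K)}|"* — PROVED on
the model's tori `T^{(k)}` (`HiggsLattice.Site P k`, distance (I.1.3) in lattice units): a polynomial of the printed shape (I.3.57)
whose kernels obey the tree-decay bound (I.3.58) AND VANISH UNLESS ONE OF THEIR POINTS LIES IN A REGION `Λ ⊂ T^{(k)}`, with field
arguments bounded pointwise, is bounded by `O(1)·|Λ|` — the number of points of the REGION, not of the torus — every constant explicit.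
The region-localized companion of p14's `B1Ineq358TreeDecaySum` (the `O(1)·|T₁^{(k)}|` summation of part I p. 625), whose
`diam`/`treeConst`/`poly357` are used BY NAME

statement-level skeleton of published theorems with citation tags; proofs where landed; nothing here is a claim about the Yang–Mills mass gap

PDF held: `paper:balaban1982-cmp86-higgs23-ii` (journal page = PDF page + 554); p. 570 [PDF 16] (Prop. 2.1, (2.57)), p. 580 [PDF 26]
(Prop. 2.6), p. 582 [PDF 28] ((2.116)) read on the text layer `~/.lit/texts/paper-balaban1982-cmp86-higgs23-ii/p00{16,26,28}.txt`;
part I [Balaban1982Higgs1] p. 622 [PDF 20] (Prop. 3.2, (3.57)–(3.58)) as quoted in `B1Ineq358TreeDecaySum`.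

CITATION HEADER (lean-in-tree rule).  Cell `lit-balaban` (HOME `run/shared/lean/pub/lit-balaban/`), unit `lit-balaban-typer` gen 17
(literature-prover-lit-balaban-typer-g17-0; the typer's own lineage = the concrete (Higgs)₂,₃ carriers and regions tower
`B2Eq28RegionsConcrete`/`B2Eq255RegionsWindow`/`B2Eq243RegionsTower`; TAKING line HOME/STATUS.md 2026-08-22T05:2xZ), file 1 of 2.
SKELETON rows **B2.Eq2.116** (owner r02, second reader r14; decl of record `B2Sect2Statements.Ineq2116` — untouched; file 2 inhabits it
for a displayed-input family) and **B2.Prop2.1** / **B2.Prop2.6** (cells only: the `O(·)|region|` shape).  USED BY NAME, never restated: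
`B1Ineq358TreeDecaySum.{diam, tdist_le_diam, exp_neg_diam_le_prod, treeConst, poly357, abs_prod_leg_le, polyConst}` (p14 g12),
`B2Eq230CondShiftBound.sum_exp_neg_tdist_le` (the uniform one-point torus sum, typer g9), `B4Sect5Proof.latticeConst` (r01).

WHAT IS PRINTED (verbatim, text layer).  p. 570: *"Proposition 2.1. Under the conditions (2.55), we have 𝒫^{(k)}(Λ₇^{(k−1)′}, θ_kA^{(k)}, φ)
= −λ(Lᵏε) Σ_{x∈Bᵏ(Λ₇^{(k−1)′}∩Λ₇^{(k)c})} ηᵈ|φ^{(k)}(x)|⁴ + 𝒫^{(k)}(Λ₇^{(k)}, θ_kA^{(k)}, φ) + O((Lᵏε)^{κ₀})|Λ₇^{(k−1)′}∩Λ₇^{(k)c}|. (2.57) …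
This theorem is a corollary of the analysis of the perturbation expansions."*  p. 580: *"Proposition 2.6. If in the interaction terms
localized in Bᵏ(Λ₇^{(k)}) we replace the propagator … then all the terms containing at least one difference of these propagators can be
estimated by O((Lᵏε)^κ)|Λ₇^{(k)}|."*  p. 582: *"D. The Final Step.  The procedure is continued until k = K, where K is such that Lᴷε ≦ ε₀,
Lᴷ⁺¹ε > ε₀. Then we estimate 𝒫^{(K),Lᴷε}(Λ₇^{(K−1)}, B^{(K),ε}, ψ) ≦ O((Lᴷε)^{κ₀})|Λ₇^{(K)}|. (2.116)"*  Part I p. 622 (Prop. 3.2): the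
representation (3.57) `V^{(k)} = Σ_{n,m} Σ_{x₁…y_m} Σ_{j;μ} v^{(k)}(…; x₁,…,y_m) φ′_{j₁}(x₁)…A′_{μ_m}(y_m)` with `|v^{(k)}(…)| ≦ O(1)(Lᵏε)^{κ₀}
exp(−δ₀d(x₁,…,y_m))` (3.58), `d` = *"a length of the shortest graph connecting the points"*.

THE ARGUMENT (the print's «O(·)|Λ₇|», made explicit).  A term *"localized in Bᵏ(Λ₇^{(k)})"* has at least one of its points in the
region; pin that point: `e^{−δ·diam z} ≦ Π_{i≠i₀} e^{−(δ/r)|z_{i₀} − z_i|}` (every pairwise distance is `≦ diam`), sum the pinned point over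
`Λ` and the `r = q − 1` others over the torus with the uniform one-point bound `Σ_y e^{−(δ/r)|x−y|} ≦ K_d(δ/r)`: `Σ_{z, z_{i₀}∈Λ} e^{−δ·diam z}
≦ |Λ|·K_d(δ/r)^r`; a union bound over the pinned coordinate costs a factor `q`.  Hence `|V_Λ| ≦ A₀·|Λ|·Σ_{q≦q̄} q(|Lbl|q₀)^q·treeConst_q`.

WHAT THIS FILE PROVES (kernel-checked, zero `sorry`; axioms standard; theorems + two `ℝ`-valued constants; no `Prop`-valued definition).
* §1 `diam_le_of_forall`, `diam_comp_perm` (the diameter is symmetric in the points); **`sum_exp_neg_diam_pin_zero_le`** /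
  **`sum_exp_neg_diam_pin_le`** (`Σ_{z : Fin (r+1) → T^{(k)}, z_{i₀} ∈ Λ} e^{−δ·diam z} ≦ |Λ|·K_d(δ/r)^r`, any pinned coordinate `i₀`);
  **`sum_exp_neg_diam_loc_le`** (`Σ_{z : Fin q → T^{(k)}, ∃ i, z_i ∈ Λ} e^{−δ·diam z} ≦ q·|Λ|·treeConst_q`, every `q`).
* §2 `polyConstLoc` (`Σ_{q≦qmax} q·(nΛ·q₀)^q·treeConst_q`), `polyConstLoc_nonneg`, `polyConstLoc_le` (`≦ qmax·polyConst`: at most `qmax` times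
  p14's torus constant), `sum_abs_term_loc_le`, and **`abs_poly357_loc_le`**: if the kernels of a polynomial of the shape (I.3.57) satisfy
  `|c(q; z; κ)| ≦ A₀e^{−δ₀·diam z}` and VANISH when no `z_i` lies in `Λ`, and the field components obey `|leg(l, x)| ≦ q₀`, then
  `|V| ≦ A₀·|Λ|·polyConstLoc(qmax, |Lbl|, q₀, d, δ₀)`.
* §3 the printed currency: **`abs_poly357_loc_le_scale`** — with `A₀ = C₀·s^{κ₀}` (`s = Lᵏε`), `|V| ≦ (C₀·polyConstLoc)·s^{κ₀}·|Λ|`, i.e. the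
  shape `O((Lᵏε)^{κ₀})|Λ₇^{(k)}|` of (2.57)/(2.116) with its `O(1)` explicit and independent of `k`, `ε`, the torus and the region.
HONEST SCOPE.  Pure lattice combinatorics on the model's tori; NOTHING about the kernels of Bałaban's expansion themselves (Prop. 2.1 / Prop. 2.6 /
the bounds (I.3.58) are *"a corollary of the analysis of the perturbation expansions"* — paper III — and are NOT proved here or in file 2, which
DISPLAYS them as hypotheses exactly as p14's `B1Prop32InteractionBound` does for part I).  The Steiner length `d(…)` of (I.3.58) is not
formalised — only its consequence `d ≧ diam` is used, so the kernel hypothesis here is implied by (I.3.58) as printed.  *"Localized in Bᵏ(Λ₇)"* is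
read as *at least one point of the term lies in the region* (the weakest reading; the all-points reading is a sub-case for `q ≧ 1`); a term with
no point (`q = 0`, a field-independent constant) carries no localization and its kernel is made to vanish by `hloc`.  Nothing here is summit
progress.
-/

open scoped BigOperators

namespace Literature.MathematicalPhysics.QuantumFieldTheory.Balaban1983to89.B2Ineq2116TreeDecayRegion

open Literature.MathematicalPhysics.QuantumFieldTheory.Balaban1983to89.B2Eq230CondShiftBound (sum_exp_neg_tdist_le)
open Literature.MathematicalPhysics.QuantumFieldTheory.Balaban1983to89.B4Sect5Proof (latticeConst latticeConst_nonneg)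
open Literature.MathematicalPhysics.QuantumFieldTheory.Balaban1983to89.B1Ineq358TreeDecaySum
  (diam tdist_le_diam exp_neg_diam_le_prod treeConst treeConst_nonneg poly357 abs_prod_leg_le polyConst)

variable {P : HiggsLattice.Params} {k : ℕ}

/-! ## §1 Tree-decay summation with one point pinned in a region `Λ ⊂ T^{(k)}` -/

section Pinned

/-- The diameter is the least common bound of the pairwise distances. [cite: Balaban1982Higgs1, Prop. 3.2 (3.58) p.622] -/
theorem diam_le_of_forall {q : ℕ} (z : Fin q → HiggsLattice.Site P k) {n : ℕ}
    (h : ∀ i j, HiggsLattice.Site.tdist (z i) (z j) ≤ n) : diam z ≤ n := by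
  unfold B1Ineq358TreeDecaySum.diam
  exact Finset.sup_le fun i _ => Finset.sup_le fun j _ => h i j

/-- The diameter of a point tuple does not depend on the order of the points. [cite: Balaban1982Higgs1, Prop. 3.2 (3.58) p.622] -/
theorem diam_comp_perm {q : ℕ} (z : Fin q → HiggsLattice.Site P k) (σ : Equiv.Perm (Fin q)) : diam (z ∘ σ) = diam z := by
  refine le_antisymm (diam_le_of_forall _ fun i j => tdist_le_diam z (σ i) (σ j)) (diam_le_of_forall _ fun i j => ?_)
  have h := tdist_le_diam (z ∘ σ) (σ.symm i) (σ.symm j)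
  simpa only [Function.comp_apply, Equiv.apply_symm_apply] using h

/-- **Pinned tree-decay summation (first coordinate)**: for `δ > 0`, a finite set of sites `Λ ⊂ T^{(k)}` and `q = r + 1` points,
`Σ_{z : Fin (r+1) → T^{(k)}, z₀ ∈ Λ} e^{−δ·diam z} ≦ |Λ|·K_d(δ/r)^r` — the star bound at `z₀` (`exp_neg_diam_le_prod`), the pinned point
summed over `Λ` only, the other `r` points over the torus with the uniform one-point bound `Σ_y e^{−(δ/r)|x − y|} ≦ K_d(δ/r)`.  This is the
summation behind the shape `O(·)·|Λ₇^{(k)}|` of the terms *"localized in Bᵏ(Λ₇^{(k)})"*. [cite: Balaban1982Higgs2, Prop. 2.6 p.580; (2.116) p.582] -/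
theorem sum_exp_neg_diam_pin_zero_le {r : ℕ} {δ : ℝ} (hδ : 0 < δ) (Λ : Finset (HiggsLattice.Site P k)) :
    ∑ z : Fin (r + 1) → HiggsLattice.Site P k, (if z 0 ∈ Λ then Real.exp (-(δ * (diam z : ℝ))) else 0)
      ≤ (Λ.card : ℝ) * latticeConst P.d (δ / r) ^ r := by
  set f : HiggsLattice.Site P k → HiggsLattice.Site P k → ℝ :=
    fun a y => Real.exp (-(δ / r * (HiggsLattice.Site.tdist a y : ℝ))) with hf
  -- termwise: the star bound at the pinned point
  have h1 : ∑ z : Fin (r + 1) → HiggsLattice.Site P k, (if z 0 ∈ Λ then Real.exp (-(δ * (diam z : ℝ))) else 0)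
      ≤ ∑ z : Fin (r + 1) → HiggsLattice.Site P k, (if z 0 ∈ Λ then ∏ i : Fin r, f (z 0) (z i.succ) else 0) := by
    refine Finset.sum_le_sum fun z _ => ?_
    split_ifs
    · exact exp_neg_diam_le_prod hδ.le z
    · exact le_rfl
  -- reindex `z = Fin.cons a w`
  have h2 : ∑ z : Fin (r + 1) → HiggsLattice.Site P k, (if z 0 ∈ Λ then ∏ i : Fin r, f (z 0) (z i.succ) else 0)
      = ∑ a : HiggsLattice.Site P k, ∑ w : Fin r → HiggsLattice.Site P k, (if a ∈ Λ then ∏ i : Fin r, f a (w i) else 0) := by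
    rw [← (Fin.consEquiv fun _ : Fin (r + 1) => HiggsLattice.Site P k).sum_comp, Fintype.sum_prod_type]
    refine Finset.sum_congr rfl fun a _ => Finset.sum_congr rfl fun w _ => ?_
    simp only [Fin.consEquiv_apply, Fin.cons_zero, Fin.cons_succ]
  -- the inner sum is a power of the one-point sum (or zero)
  have h3 : ∀ a : HiggsLattice.Site P k,
      ∑ w : Fin r → HiggsLattice.Site P k, (if a ∈ Λ then ∏ i : Fin r, f a (w i) else 0)
        = if a ∈ Λ then (∑ y : HiggsLattice.Site P k, f a y) ^ r else 0 := by
    intro a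
    split_ifs
    · exact (Fintype.sum_pow (f a) r).symm
    · simp
  have h4 : ∀ a : HiggsLattice.Site P k, (∑ y : HiggsLattice.Site P k, f a y) ^ r ≤ latticeConst P.d (δ / r) ^ r := by
    intro a
    rcases Nat.eq_zero_or_pos r with hr | hr
    · subst hr
      simp
    · have hδr : 0 < δ / r := div_pos hδ (by exact_mod_cast hr)
      exact pow_le_pow_left₀ (Finset.sum_nonneg fun y _ => (Real.exp_pos _).le) (sum_exp_neg_tdist_le hδr a) r
  have h5 : ∑ a : HiggsLattice.Site P k, (if a ∈ Λ then latticeConst P.d (δ / r) ^ r else 0)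
      = (Λ.card : ℝ) * latticeConst P.d (δ / r) ^ r := by
    rw [← Finset.sum_filter, Finset.filter_mem_eq_inter, Finset.univ_inter, Finset.sum_const, nsmul_eq_mul]
  calc ∑ z : Fin (r + 1) → HiggsLattice.Site P k, (if z 0 ∈ Λ then Real.exp (-(δ * (diam z : ℝ))) else 0)
      ≤ ∑ a : HiggsLattice.Site P k, ∑ w : Fin r → HiggsLattice.Site P k, (if a ∈ Λ then ∏ i : Fin r, f a (w i) else 0) :=
        h1.trans_eq h2
    _ = ∑ a : HiggsLattice.Site P k, (if a ∈ Λ then (∑ y : HiggsLattice.Site P k, f a y) ^ r else 0) :=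
        Finset.sum_congr rfl fun a _ => h3 a
    _ ≤ ∑ a : HiggsLattice.Site P k, (if a ∈ Λ then latticeConst P.d (δ / r) ^ r else 0) := by
        refine Finset.sum_le_sum fun a _ => ?_
        split_ifs
        · exact h4 a
        · exact le_rfl
    _ = (Λ.card : ℝ) * latticeConst P.d (δ / r) ^ r := h5

/-- **Pinned tree-decay summation (any coordinate)**: `Σ_{z : Fin (r+1) → T^{(k)}, z_{i₀} ∈ Λ} e^{−δ·diam z} ≦ |Λ|·K_d(δ/r)^r` for every
pinned coordinate `i₀` — the points are reordered by the transposition `(0 i₀)`, which leaves the diameter unchanged (`diam_comp_perm`).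
[cite: Balaban1982Higgs2, Prop. 2.6 p.580; (2.116) p.582] -/
theorem sum_exp_neg_diam_pin_le {r : ℕ} {δ : ℝ} (hδ : 0 < δ) (Λ : Finset (HiggsLattice.Site P k)) (i₀ : Fin (r + 1)) :
    ∑ z : Fin (r + 1) → HiggsLattice.Site P k, (if z i₀ ∈ Λ then Real.exp (-(δ * (diam z : ℝ))) else 0)
      ≤ (Λ.card : ℝ) * latticeConst P.d (δ / r) ^ r := by
  set σ : Equiv.Perm (Fin (r + 1)) := Equiv.swap 0 i₀ with hσ
  -- `e z = z ∘ σ` is a bijection of the tuples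
  set e : (Fin (r + 1) → HiggsLattice.Site P k) ≃ (Fin (r + 1) → HiggsLattice.Site P k) :=
    Equiv.arrowCongr σ (Equiv.refl (HiggsLattice.Site P k)) with he
  have he' : ∀ z : Fin (r + 1) → HiggsLattice.Site P k, e z = z ∘ σ := by
    intro z
    funext i
    simp only [he, Equiv.arrowCongr_apply, Equiv.coe_refl, Function.comp_apply, id_eq, hσ, Equiv.symm_swap]
  rw [← e.sum_comp]
  have hpt : ∀ z : Fin (r + 1) → HiggsLattice.Site P k,
      (if (e z) i₀ ∈ Λ then Real.exp (-(δ * (diam (e z) : ℝ))) else 0)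
        = (if z 0 ∈ Λ then Real.exp (-(δ * (diam z : ℝ))) else 0) := by
    intro z
    rw [he' z, diam_comp_perm z σ]
    simp only [Function.comp_apply, hσ, Equiv.swap_apply_right]
  rw [Finset.sum_congr rfl fun z _ => hpt z]
  exact sum_exp_neg_diam_pin_zero_le hδ Λ

/-- **Localized tree-decay summation**: for every number `q` of points, `Σ_{z : Fin q → T^{(k)}, ∃ i, z_i ∈ Λ} e^{−δ·diam z} ≦ q·|Λ|·treeConst_q`
(union bound over the coordinate that lies in `Λ`, then `sum_exp_neg_diam_pin_le`; `q = 0`: no tuple has a point in `Λ`, both sides vanish).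
[cite: Balaban1982Higgs2, Prop. 2.6 p.580; (2.116) p.582] -/
theorem sum_exp_neg_diam_loc_le {δ : ℝ} (hδ : 0 < δ) (Λ : Finset (HiggsLattice.Site P k)) : ∀ q : ℕ,
    ∑ z : Fin q → HiggsLattice.Site P k, (if ∃ i, z i ∈ Λ then Real.exp (-(δ * (diam z : ℝ))) else 0)
      ≤ (q : ℝ) * (Λ.card : ℝ) * treeConst P.d δ q
  | 0 => by simp
  | r + 1 => by
    have hpt : ∀ z : Fin (r + 1) → HiggsLattice.Site P k,
        (if ∃ i, z i ∈ Λ then Real.exp (-(δ * (diam z : ℝ))) else 0)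
          ≤ ∑ i : Fin (r + 1), (if z i ∈ Λ then Real.exp (-(δ * (diam z : ℝ))) else 0) := by
      intro z
      split_ifs with h
      · obtain ⟨i, hi⟩ := h
        have hsum := Finset.single_le_sum (f := fun j => if z j ∈ Λ then Real.exp (-(δ * (diam z : ℝ))) else 0)
          (fun j _ => by positivity) (Finset.mem_univ i)
        simp only [if_pos hi] at hsum
        exact hsum
      · exact Finset.sum_nonneg fun j _ => by positivity
    calc ∑ z : Fin (r + 1) → HiggsLattice.Site P k, (if ∃ i, z i ∈ Λ then Real.exp (-(δ * (diam z : ℝ))) else 0)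
        ≤ ∑ z : Fin (r + 1) → HiggsLattice.Site P k, ∑ i : Fin (r + 1),
            (if z i ∈ Λ then Real.exp (-(δ * (diam z : ℝ))) else 0) := Finset.sum_le_sum fun z _ => hpt z
      _ = ∑ i : Fin (r + 1), ∑ z : Fin (r + 1) → HiggsLattice.Site P k,
            (if z i ∈ Λ then Real.exp (-(δ * (diam z : ℝ))) else 0) := Finset.sum_comm
      _ ≤ ∑ _i : Fin (r + 1), (Λ.card : ℝ) * latticeConst P.d (δ / r) ^ r :=
          Finset.sum_le_sum fun i _ => sum_exp_neg_diam_pin_le hδ Λ i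
      _ = ((r + 1 : ℕ) : ℝ) * (Λ.card : ℝ) * treeConst P.d δ (r + 1) := by
          rw [Finset.sum_const, Finset.card_univ, Fintype.card_fin, nsmul_eq_mul]
          simp only [B1Ineq358TreeDecaySum.treeConst]
          ring

end Pinned

/-! ## §2 A polynomial of the shape (I.3.57) LOCALIZED in a region: the bound `O(1)·|Λ|` -/

section Poly

variable {Lbl : Type} [Fintype Lbl]

/-- The explicit `O(1)` of the region-sized bound (per unit of `A₀·|Λ|`): `Σ_{q≦qmax} q·(nΛ·q₀)^q·treeConst_q` — p14's `polyConst` with the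
extra factor `q` (the choice of the point lying in the region); it depends on the degree bound, the number `nΛ` of field components, the field
bound `q₀`, the dimension and `δ₀` only. [cite: Balaban1982Higgs2, (2.116) p.582; Prop. 2.6 p.580] -/
noncomputable def polyConstLoc (qmax : ℕ) (nΛ q₀ : ℝ) (d : ℕ) (δ₀ : ℝ) : ℝ :=
  ∑ q ∈ Finset.range (qmax + 1), (q : ℝ) * (nΛ * q₀) ^ q * treeConst d δ₀ q

/-- `polyConstLoc ≧ 0` for `nΛ·q₀ ≧ 0`, `δ₀ ≧ 0`. [cite: Balaban1982Higgs2, (2.116) p.582] -/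
theorem polyConstLoc_nonneg (qmax : ℕ) {nΛ q₀ : ℝ} (h : 0 ≤ nΛ * q₀) (d : ℕ) {δ₀ : ℝ} (hδ : 0 ≤ δ₀) :
    0 ≤ polyConstLoc qmax nΛ q₀ d δ₀ :=
  Finset.sum_nonneg fun q _ => mul_nonneg (mul_nonneg (Nat.cast_nonneg q) (pow_nonneg h q)) (treeConst_nonneg d hδ q)

/-- The localized constant is at most `qmax` times the torus constant of part I p. 625 (`B1Ineq358TreeDecaySum.polyConst`).
[cite: Balaban1982Higgs2, (2.116) p.582] -/
theorem polyConstLoc_le (qmax : ℕ) {nΛ q₀ : ℝ} (h : 0 ≤ nΛ * q₀) (d : ℕ) {δ₀ : ℝ} (hδ : 0 ≤ δ₀) :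
    polyConstLoc qmax nΛ q₀ d δ₀ ≤ (qmax : ℝ) * polyConst qmax nΛ q₀ d δ₀ := by
  unfold polyConstLoc B1Ineq358TreeDecaySum.polyConst
  rw [Finset.mul_sum]
  refine Finset.sum_le_sum fun q hq => ?_
  have hq' : (q : ℝ) ≤ qmax := by exact_mod_cast Nat.lt_succ_iff.mp (Finset.mem_range.mp hq)
  have h0 : 0 ≤ (nΛ * q₀) ^ q * treeConst d δ₀ q := mul_nonneg (pow_nonneg h q) (treeConst_nonneg d hδ q)
  calc (q : ℝ) * (nΛ * q₀) ^ q * treeConst d δ₀ q = (q : ℝ) * ((nΛ * q₀) ^ q * treeConst d δ₀ q) := by ring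
    _ ≤ (qmax : ℝ) * ((nΛ * q₀) ^ q * treeConst d δ₀ q) := mul_le_mul_of_nonneg_right hq' h0

/-- One degree, localized: `Σ_z Σ_κ |c(q;z;κ)|·|Π leg| ≦ A₀·(q·|Λ|)·(|Lbl|q₀)^q·treeConst_q` under the kernel bound `|c| ≦ A₀e^{−δ₀·diam z}`, the
localization `c(q;z;κ) = 0` unless some `z_i ∈ Λ`, and `|leg| ≦ q₀`. [cite: Balaban1982Higgs2, Prop. 2.6 p.580; (2.116) p.582] -/
theorem sum_abs_term_loc_le (q : ℕ) (coef : (q : ℕ) → (Fin q → HiggsLattice.Site P k) → (Fin q → Lbl) → ℝ)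
    (leg : Lbl → HiggsLattice.Site P k → ℝ) (Λ : Finset (HiggsLattice.Site P k))
    {A₀ δ₀ q₀ : ℝ} (hA₀ : 0 ≤ A₀) (hδ₀ : 0 < δ₀) (hq₀ : 0 ≤ q₀)
    (hcoef : ∀ (z : Fin q → HiggsLattice.Site P k) (κ : Fin q → Lbl), |coef q z κ| ≤ A₀ * Real.exp (-(δ₀ * (diam z : ℝ))))
    (hloc : ∀ (z : Fin q → HiggsLattice.Site P k) (κ : Fin q → Lbl), (∀ i, z i ∉ Λ) → coef q z κ = 0)
    (hleg : ∀ l x, |leg l x| ≤ q₀) :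
    ∑ z : Fin q → HiggsLattice.Site P k, ∑ κ : Fin q → Lbl, |coef q z κ * ∏ i, leg (κ i) (z i)|
      ≤ A₀ * ((q : ℝ) * (Λ.card : ℝ)) * ((Fintype.card Lbl : ℝ) * q₀) ^ q * treeConst P.d δ₀ q := by
  have hterm : ∀ (z : Fin q → HiggsLattice.Site P k) (κ : Fin q → Lbl),
      |coef q z κ * ∏ i, leg (κ i) (z i)|
        ≤ A₀ * (if ∃ i, z i ∈ Λ then Real.exp (-(δ₀ * (diam z : ℝ))) else 0) * q₀ ^ q := by
    intro z κ
    rw [abs_mul]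
    by_cases h : ∃ i, z i ∈ Λ
    · rw [if_pos h]
      exact mul_le_mul (hcoef z κ) (abs_prod_leg_le leg hleg z κ) (abs_nonneg _) (mul_nonneg hA₀ (Real.exp_pos _).le)
    · rw [if_neg h]
      push Not at h
      rw [hloc z κ h, abs_zero, zero_mul, mul_zero, zero_mul]
  calc ∑ z : Fin q → HiggsLattice.Site P k, ∑ κ : Fin q → Lbl, |coef q z κ * ∏ i, leg (κ i) (z i)|
      ≤ ∑ z : Fin q → HiggsLattice.Site P k, ∑ _κ : Fin q → Lbl,
          A₀ * (if ∃ i, z i ∈ Λ then Real.exp (-(δ₀ * (diam z : ℝ))) else 0) * q₀ ^ q :=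
        Finset.sum_le_sum fun z _ => Finset.sum_le_sum fun κ _ => hterm z κ
    _ = (A₀ * q₀ ^ q * (Fintype.card Lbl : ℝ) ^ q) *
          ∑ z : Fin q → HiggsLattice.Site P k, (if ∃ i, z i ∈ Λ then Real.exp (-(δ₀ * (diam z : ℝ))) else 0) := by
        rw [Finset.mul_sum]
        refine Finset.sum_congr rfl fun z _ => ?_
        rw [Finset.sum_const, Finset.card_univ, Fintype.card_fun, Fintype.card_fin, nsmul_eq_mul]
        push_cast
        ring
    _ ≤ (A₀ * q₀ ^ q * (Fintype.card Lbl : ℝ) ^ q) * ((q : ℝ) * (Λ.card : ℝ) * treeConst P.d δ₀ q) :=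
        mul_le_mul_of_nonneg_left (sum_exp_neg_diam_loc_le hδ₀ Λ q) (by positivity)
    _ = A₀ * ((q : ℝ) * (Λ.card : ℝ)) * ((Fintype.card Lbl : ℝ) * q₀) ^ q * treeConst P.d δ₀ q := by ring

/-- **THE REGION-SIZED BOUND, abstract form** — the summation behind *"the interaction terms localized in Bᵏ(Λ₇^{(k)}) … can be estimated by
O(·)|Λ₇^{(k)}|"* (Prop. 2.6 p. 580) and *"𝒫^{(K),Lᴷε}(Λ₇^{(K−1)}, B^{(K),ε}, ψ) ≦ O((Lᴷε)^{κ₀})|Λ₇^{(K)}|"* ((2.116) p. 582): if the kernels of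
a polynomial of the shape (I.3.57) satisfy `|c(q; z; κ)| ≦ A₀e^{−δ₀·diam z}` (the bound (I.3.58) with `A₀ = O(1)(Lᵏε)^{κ₀}`, the diameter in
place of the printed length `d ≧ diam`) and VANISH unless one of the points `z_i` lies in the region `Λ`, and the field components obey
`|leg(l, x)| ≦ q₀`, then `|V| ≦ A₀·|Λ|·polyConstLoc(qmax, |Lbl|, q₀, d, δ₀)` — the region's size in place of the torus's.
[cite: Balaban1982Higgs2, (2.116) p.582; Prop. 2.6 p.580; Prop. 2.1 (2.57) p.570] -/
theorem abs_poly357_loc_le (qmax : ℕ) (coef : (q : ℕ) → (Fin q → HiggsLattice.Site P k) → (Fin q → Lbl) → ℝ)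
    (leg : Lbl → HiggsLattice.Site P k → ℝ) (Λ : Finset (HiggsLattice.Site P k))
    {A₀ δ₀ q₀ : ℝ} (hA₀ : 0 ≤ A₀) (hδ₀ : 0 < δ₀) (hq₀ : 0 ≤ q₀)
    (hcoef : ∀ q, q ≤ qmax → ∀ (z : Fin q → HiggsLattice.Site P k) (κ : Fin q → Lbl),
      |coef q z κ| ≤ A₀ * Real.exp (-(δ₀ * (diam z : ℝ))))
    (hloc : ∀ q, q ≤ qmax → ∀ (z : Fin q → HiggsLattice.Site P k) (κ : Fin q → Lbl), (∀ i, z i ∉ Λ) → coef q z κ = 0)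
    (hleg : ∀ l x, |leg l x| ≤ q₀) :
    |poly357 qmax coef leg| ≤ A₀ * (Λ.card : ℝ) * polyConstLoc qmax (Fintype.card Lbl) q₀ P.d δ₀ := by
  unfold B1Ineq358TreeDecaySum.poly357 polyConstLoc
  rw [Finset.mul_sum]
  refine (Finset.abs_sum_le_sum_abs _ _).trans (Finset.sum_le_sum fun q hq => ?_)
  have hq' : q ≤ qmax := Nat.lt_succ_iff.mp (Finset.mem_range.mp hq)
  refine (Finset.abs_sum_le_sum_abs _ _).trans ?_
  refine (Finset.sum_le_sum fun z _ => Finset.abs_sum_le_sum_abs _ _).trans ?_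
  have h := sum_abs_term_loc_le q coef leg Λ hA₀ hδ₀ hq₀ (hcoef q hq') (hloc q hq') hleg
  calc ∑ z : Fin q → HiggsLattice.Site P k, ∑ κ : Fin q → Lbl, |coef q z κ * ∏ i, leg (κ i) (z i)|
      ≤ A₀ * ((q : ℝ) * (Λ.card : ℝ)) * ((Fintype.card Lbl : ℝ) * q₀) ^ q * treeConst P.d δ₀ q := h
    _ = A₀ * (Λ.card : ℝ) * ((q : ℝ) * ((Fintype.card Lbl : ℝ) * q₀) ^ q * treeConst P.d δ₀ q) := by ring

end Poly

/-! ## §3 The printed currency `O((Lᵏε)^{κ₀})·|Λ₇^{(k)}|` -/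

section Scale

variable {Lbl : Type} [Fintype Lbl]

/-- **The shape of (2.57)/(2.116) with its `O(1)` explicit**: if the kernels obey (I.3.58) in the form `|c(q; z; κ)| ≦ C₀·s^{κ₀}·e^{−δ₀·diam z}`
(`s = Lᵏε`, `C₀` the print's `O(1)`), vanish unless a point lies in `Λ`, and `|leg| ≦ q₀`, then
`|V| ≦ (C₀·polyConstLoc(qmax, |Lbl|, q₀, d, δ₀))·s^{κ₀}·|Λ|` — ONE constant, independent of `k`, `ε`, the torus and the region.
[cite: Balaban1982Higgs2, (2.116) p.582; Prop. 2.1 (2.57) p.570] -/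
theorem abs_poly357_loc_le_scale (qmax : ℕ) (coef : (q : ℕ) → (Fin q → HiggsLattice.Site P k) → (Fin q → Lbl) → ℝ)
    (leg : Lbl → HiggsLattice.Site P k → ℝ) (Λ : Finset (HiggsLattice.Site P k))
    {C₀ s κ₀ δ₀ q₀ : ℝ} (hC₀ : 0 ≤ C₀) (hs : 0 ≤ s) (hδ₀ : 0 < δ₀) (hq₀ : 0 ≤ q₀)
    (hcoef : ∀ q, q ≤ qmax → ∀ (z : Fin q → HiggsLattice.Site P k) (κ : Fin q → Lbl),
      |coef q z κ| ≤ C₀ * s ^ κ₀ * Real.exp (-(δ₀ * (diam z : ℝ))))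
    (hloc : ∀ q, q ≤ qmax → ∀ (z : Fin q → HiggsLattice.Site P k) (κ : Fin q → Lbl), (∀ i, z i ∉ Λ) → coef q z κ = 0)
    (hleg : ∀ l x, |leg l x| ≤ q₀) :
    |poly357 qmax coef leg|
      ≤ (C₀ * polyConstLoc qmax (Fintype.card Lbl) q₀ P.d δ₀) * s ^ κ₀ * (Λ.card : ℝ) := by
  have hA₀ : 0 ≤ C₀ * s ^ κ₀ := mul_nonneg hC₀ (Real.rpow_nonneg hs κ₀)
  have h := abs_poly357_loc_le qmax coef leg Λ hA₀ hδ₀ hq₀ hcoef hloc hleg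
  calc |poly357 qmax coef leg| ≤ C₀ * s ^ κ₀ * (Λ.card : ℝ) * polyConstLoc qmax (Fintype.card Lbl) q₀ P.d δ₀ := h
    _ = (C₀ * polyConstLoc qmax (Fintype.card Lbl) q₀ P.d δ₀) * s ^ κ₀ * (Λ.card : ℝ) := by ring

end Scale

end Literature.MathematicalPhysics.QuantumFieldTheory.Balaban1983to89.B2Ineq2116TreeDecayRegion
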